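import Summits.QuantumFields.BalabanUV.Beta.GAN24.CombLegFaceSawtoothBlockL1
import Summits.QuantumFields.BalabanUV.Beta.GAN24.ContactGaugeStaircaseCauchy
import Summits.QuantumFields.BalabanUV.Beta.GaugeMultiplierBlockMean

/-!
# `BalabanUV.Beta.GAN24.CombFacePotentialCauchy` — binder row G-an2-4 ∕ (CONV-C), TRANSFER-III, the (III′) S-slot (b) of the END R `CombChargeRowsClosed`, the (III′) WILSON
# CONTACT RATE END `hCTd′` (M.104 `CombSRowsOfContactLetters`'s SECOND hypothesis), its ONE NEW ANALYTIC INGREDIENT: **THE FACE POTENTIALS OF TWO TOP-ALIGNED DRESSED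
# PARTIAL-CHAIN OUTPUTS DIFFER BY `θ^k ×` THE UNDIFFERENCED LETTER** — `|facePotential r Lc (legAct (legChain R (ℓ+1) j) δ_{μz}) x − facePotential r Lc (legAct (legChain R ℓ j) δ_{μz}) x|
# ≤ faceWtSum r Lc·(1 + 8·Lc·(e^{κ₁}+1))·(c·θ^{ℓ+j})·(Lc^{5(j+1)})⁻¹·e^{−κ₁‖quo (Lc^{j+1}) x − z‖∞}` — the differenced twin of the OWNER gan24-p1 g47's
# `CombLegFaceSawtoothBlockL1.abs_facePotential_legChain_single_le`, PARAMETRIC in road-P2 g34's CT-4a Cauchy letter `RespStepCauchy.exists_respStep_cauchy` (`c, θ, κ₁`).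

NOT IN PRINT; OUR BOOKKEEPING (G-an2-4 formalisation swarm, leaf prover `b2b-balaban-gan24-formalise-leaf-01`, gen 89; [folklore] bookkeeping BY NAME: the OWNER's NILPOTENCY
`facePotential_legAct_legChain_eq` (only `Π^ρ_bm` of the UNDRESSED column is seen — the dressing drops out of every face potential), `BorderedHessian.axProjBmAt_sub` (`GaugeMultiplierBlockMean`), road-P2's
`ContactGaugeStaircaseCauchy.abs_bmGaugeAt_respStep_sub_le` (the rooted gauge of the differenced column), the OWNER's `abs_facePotential_le_of_abs_le` (SUP currency); 0 `def`,
0 cited facts, 0 `def … : Prop`, 0 sorry).  HONEST FRAMING (cell contract, verbatim): «discharging `BetaPertH` makes Bałaban's UV stability UNCONDITIONAL — a real constructive-QFT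
result; it is NOT the continuum limit and NOT the Clay problem.»  HONEST DEPENDENCY (verbatim): «continuum YM on T⁴ ⇐ BetaPertH ∧ nine spine estimates (0/9 proved); BetaPertH ⇐ (D1) ∧
(D4) ∧ CAP+tail; G-an2-4 gates asym, D1 and NE2/3/4.»

WHY.  The (III′) Wilson contact RATE END (and the born-Λ pair letter `hPc`) re-run MY∕road-P2's (E) two-tower chain `ContactGaugeStaircaseCauchy(Pack) → ContactGaugeRefine →
ContactRefineB∕P* → ContactCauchyCells∕Assembly` with the conjugated bond gauge function `λ′ = Ψ + PsiFace − bmGauge` (MY `CombContactGaugeStaircase`: ONE staircase, the face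
pieces `(Lc^{4i})⁻¹·facePotential (legAct (legChain R i (k−i)) δ)` at scale `i+1`).  Top-aligned, tower `k+1`'s face piece at scale `i+2` and tower `k`'s transported piece
carry THE SAME prefactor `(Lc^{4(i+1)})⁻¹` and differ by `facePotential (legChain R (i+1) (k−i) δ) − facePotential (legChain R i (k−i) δ)` — THIS file's letter (`ℓ = i`,
`j = k−i`, rate `θ^{ℓ+j} = θ^k` UNIFORMLY in the scale, as in road-P2's (α)); the staircase identities and the packaged letters are the NEXT file (`CombContactGaugeStaircaseCauchy`).
* §1 (generic `d`, in-block roots): `facePotential_sub`, **`facePotential_legChain_succ_sub_eq`** (the difference of the two face potentials IS the face potential of `Π^ρ_bm` of the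
  undressed column difference `legAct (respStep (Lc^(ℓ+1)) (Lc^(ℓ+j+2))) b − legAct (respStep (Lc^ℓ) (Lc^(ℓ+j+1))) b`).
* §2 (`d = 3`, in-block roots; PARAMETRIC in CT-4a's `c, θ, κ₁`): **`abs_axProjBmAt_respStep_sub_delta1_le`** (`Π^ρ_bm` of the differenced column keeps CT-4a's envelope, power and
  rate: `(1 + 8·Lc·(e^{κ₁}+1))·(c·θ^{ℓ+j})·(Lc^{5(j+1)})⁻¹`), **`abs_facePotential_legChain_succ_sub_le`** (THE LETTER).
NO new estimate beyond bookkeeping over CT-4a; discharges NOTHING of (hS, hSall); NEVER «G-an2-4 closed» as (CONV-C); NOT D1, NOT BetaPertH, NOT continuum, NOT Clay.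
2026-08-28; no existing file touched.
-/

noncomputable section

open Finset
open scoped BigOperators
open Literature.MathematicalPhysics.QuantumFieldTheory
open Literature.MathematicalPhysics.QuantumFieldTheory.LatticeForm (quo)
open Literature.MathematicalPhysics.QuantumFieldTheory.Balaban1983to89
open Literature.MathematicalPhysics.QuantumFieldTheory.Balaban1983to89.Beta
open B4ContourShift (supNorm supNorm_nonneg)
open AffineAveraging (Form0 Form1 Site box toSite unitVec dz)
open AveragingContours (blk blk_block grad_eq_dz)
open KKTFluctuationKernel (delta1)
open BalabanCompositeJets (respStep)
open Summit.QuantumFields.BalabanUV.Beta.AxialProjectorBlockMean (bmGaugeAt axProjBmAt)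
open Summit.QuantumFields.BalabanUV.Beta.BorderedHessian (axProjBmAt_sub)
open Summit.QuantumFields.BalabanUV.Beta.SymCorrectorFace (faceWtSum faceWtSum_nonneg)
open Summit.QuantumFields.BalabanUV.Beta.GAN24.Push4Iter (legChain)
open Summit.QuantumFields.BalabanUV.Beta.GAN24.RespStepBmDecomp (blk_blk)
open Summit.QuantumFields.BalabanUV.Beta.GAN24.RespStepBmDecompLegs (legAct)
open Summit.QuantumFields.BalabanUV.Beta.GAN24.RespStepBmDecompExact (respStepBmSeq)
open Summit.QuantumFields.BalabanUV.Beta.GAN24.UndressedResponseUnits (inv_cast_pow_pow)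
open Summit.QuantumFields.BalabanUV.Beta.GAN24.DressedLegEnvelope (legAct_delta1)
open Summit.QuantumFields.BalabanUV.Beta.GAN24.StaircaseFaces (env_add_unitVec_le)
open Summit.QuantumFields.BalabanUV.Beta.GAN24.ContactKernelCells (summable_delta1)
open Summit.QuantumFields.BalabanUV.Beta.GAN24.ContactGaugeStaircaseCauchy (abs_bmGaugeAt_respStep_sub_le)
open Summit.QuantumFields.BalabanUV.Beta.GAN24.CombLegChainGauge (facePotential facePotential_apply abs_facePotential_le_of_abs_le)
open Summit.QuantumFields.BalabanUV.Beta.GAN24.CombLegFaceSawtoothBlockL1 (facePotential_add facePotential_legAct_legChain_eq)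

namespace Summit.QuantumFields.BalabanUV.Beta.GAN24.CombFacePotentialCauchy

variable {d : ℕ}

/-! ## §1 The differenced face potential is the face potential of `Π^ρ_bm` of the undressed column difference (generic `d`) -/

/-- [folklore] The face potential is subtractive in the 1-form (`facePotential_add` on `(A − B) + B`). -/
theorem facePotential_sub (r : Fin (d + 1) → ℕ) (n : ℕ) (A B : Form1 (d + 1) ℝ) :
    facePotential r n (A - B) = facePotential r n A - facePotential r n B := by
  have h := facePotential_add r n (A - B) B
  rw [sub_add_cancel] at h
  rw [h, add_sub_cancel_right]

section Dressed

variable {Lc : ℕ} [NeZero Lc] {r : Fin (d + 1) → ℕ} (hr : r ∈ box (d + 1) Lc) {rr : Fin (d + 1) → ℕ} (hrr : rr ∈ box (d + 1) Lc)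
include hr hrr

/-- NOT IN PRINT; OUR BOOKKEEPING.  **THE FACE POTENTIALS OF TWO TOP-ALIGNED DRESSED PARTIAL-CHAIN OUTPUTS DIFFER BY THE FACE POTENTIAL OF `Π^ρ_bm` OF THE UNDRESSED COLUMN
DIFFERENCE** (generic `d`, in-block roots, summable datum; bases `ℓ+1` ∕ `ℓ`, common length `j`): the OWNER's nilpotency `facePotential_legAct_legChain_eq` twice, `facePotential_sub`,
`axProjBmAt_sub`. -/
theorem facePotential_legChain_succ_sub_eq (ℓ j : ℕ) {b : Form1 (d + 1) ℝ} (hb : ∀ μ, Summable (b μ)) :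
    facePotential r Lc (legAct (legChain (respStepBmSeq (d := d) (toSite rr) Lc) (ℓ + 1) j) b)
        - facePotential r Lc (legAct (legChain (respStepBmSeq (d := d) (toSite rr) Lc) ℓ j) b)
      = facePotential r Lc (axProjBmAt (toSite rr) Lc
          (legAct (respStep (d := d) (Lc ^ (ℓ + 1)) (Lc ^ (ℓ + j + 2))) b - legAct (respStep (d := d) (Lc ^ ℓ) (Lc ^ (ℓ + j + 1))) b)) := by
  rw [facePotential_legAct_legChain_eq hr hrr (ℓ + 1) j hb, facePotential_legAct_legChain_eq hr hrr ℓ j hb, ← facePotential_sub, ← axProjBmAt_sub,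
    show ℓ + 1 + j + 1 = ℓ + j + 2 by ring]

end Dressed

/-! ## §2 `d = 3`: the letters, parametric in CT-4a -/

section Four

variable {Lc : ℕ} [NeZero Lc] {c θ κ₁ : ℝ} (hκ₁ : 0 ≤ κ₁) (hc : 0 ≤ c) (hθ : 0 ≤ θ)
  (hCau : ∀ (s k : ℕ) (μ : Fin (3 + 1)) (z : Site (3 + 1)) (l : Fin (3 + 1)) (w : Site (3 + 1)),
    |respStep (d := 3) (Lc ^ (s + 1)) (Lc ^ (s + k + 2)) μ z l w - respStep (d := 3) (Lc ^ s) (Lc ^ (s + k + 1)) μ z l w|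
      ≤ c * θ ^ (s + k) * ((((Lc ^ (k + 1) : ℕ) : ℝ)) ^ (3 + 2))⁻¹ * Real.exp (-(κ₁ * supNorm (quo (Lc ^ (k + 1)) w - z))))
  {r : Fin (3 + 1) → ℕ} (hr : r ∈ box (3 + 1) Lc) {rr : Fin (3 + 1) → ℕ} (hrr : rr ∈ box (3 + 1) Lc)
include hκ₁ hc hθ hCau hr hrr

omit hr in
/-- NOT IN PRINT; OUR BOOKKEEPING.  **`Π^ρ_bm` OF THE DIFFERENCED UNDRESSED COLUMN KEEPS CT-4a's ENVELOPE, POWER AND RATE** (`d = 3`, in-block root; PARAMETRIC in `c, θ, κ₁`): for ALL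
`ℓ j μ z κ u`, `|Π^ρ_bm (legAct (respStep (Lc^(ℓ+1)) (Lc^(ℓ+j+2))) δ_{μz} − legAct (respStep (Lc^ℓ) (Lc^(ℓ+j+1))) δ_{μz}) κ u| ≤ (1 + 8·Lc·(e^{κ₁}+1))·(c·θ^{ℓ+j})·(Lc^{5(j+1)})⁻¹·e^{−κ₁‖quo (Lc^{j+1}) u − z‖∞}` —
the differenced twin of the OWNER's `abs_axProjBmAt_respStep_single_le`: the entry by CT-4a, the two rooted gauges (at `u + e_κ`, `u`) by road-P2's `abs_bmGaugeAt_respStep_sub_le`,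
the unit shift costs `e^{κ₁}`. -/
theorem abs_axProjBmAt_respStep_sub_delta1_le (ℓ j : ℕ) (μ : Fin (3 + 1)) (z : Site (3 + 1)) (κ : Fin (3 + 1)) (u : Site (3 + 1)) :
    |axProjBmAt (toSite rr) Lc
        (legAct (respStep (d := 3) (Lc ^ (ℓ + 1)) (Lc ^ (ℓ + j + 2))) (delta1 μ z) - legAct (respStep (d := 3) (Lc ^ ℓ) (Lc ^ (ℓ + j + 1))) (delta1 μ z)) κ u|
      ≤ (1 + 8 * (Lc : ℝ) * (Real.exp κ₁ + 1)) * (c * θ ^ (ℓ + j)) * ((Lc : ℝ) ^ (5 * (j + 1)))⁻¹ *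
          Real.exp (-(κ₁ * supNorm (quo (Lc ^ (j + 1)) u - z))) := by
  haveI : NeZero (Lc ^ (j + 1)) := ⟨pow_ne_zero _ (NeZero.ne Lc)⟩
  set E : ℝ := Real.exp (-(κ₁ * supNorm (quo (Lc ^ (j + 1)) u - z))) with hE
  have hE0 : 0 ≤ E := (Real.exp_pos _).le
  -- the entry of the differenced column
  have h0 : |(legAct (respStep (d := 3) (Lc ^ (ℓ + 1)) (Lc ^ (ℓ + j + 2))) (delta1 μ z) - legAct (respStep (d := 3) (Lc ^ ℓ) (Lc ^ (ℓ + j + 1))) (delta1 μ z)) κ u|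
      ≤ c * θ ^ (ℓ + j) * ((Lc : ℝ) ^ (5 * (j + 1)))⁻¹ * E := by
    rw [Pi.sub_apply, Pi.sub_apply, legAct_delta1, legAct_delta1]
    have h := hCau ℓ j μ z κ u
    rwa [inv_cast_pow_pow] at h
  -- the rooted gauge of the differenced column, at `u + e_κ` and at `u`
  have hgauge : ∀ w : Site (3 + 1),
      |bmGaugeAt (toSite rr) (legAct (respStep (d := 3) (Lc ^ (ℓ + 1)) (Lc ^ (ℓ + j + 2))) (delta1 μ z) - legAct (respStep (d := 3) (Lc ^ ℓ) (Lc ^ (ℓ + j + 1))) (delta1 μ z)) Lc w|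
        ≤ 8 * (Lc : ℝ) * (c * θ ^ (ℓ + j)) * ((Lc : ℝ) ^ (5 * (j + 1)))⁻¹ * Real.exp (-(κ₁ * supNorm (quo (Lc ^ (j + 1)) w - z))) := by
    intro w
    have h := abs_bmGaugeAt_respStep_sub_le (Lc := Lc) hCau hrr ℓ j μ z w
    have hlab : blk (Lc ^ j) (blk Lc w) = quo (Lc ^ (j + 1)) w := by
      show _ = blk (Lc ^ (j + 1)) w
      rw [blk_blk, ← pow_succ']
    rw [hlab] at h
    exact h
  unfold axProjBmAt
  rw [Pi.sub_apply, Pi.sub_apply, grad_eq_dz]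
  simp only [dz]
  have h1 := hgauge (u + unitVec κ)
  have h2 := hgauge u
  have h3 := env_add_unitVec_le (N := Lc ^ (j + 1)) hκ₁ z u κ
  rw [← hE] at h2 h3
  have hA : 0 ≤ 8 * (Lc : ℝ) * (c * θ ^ (ℓ + j)) * ((Lc : ℝ) ^ (5 * (j + 1)))⁻¹ := by positivity
  have h1' := h1.trans (mul_le_mul_of_nonneg_left h3 hA)
  refine ((abs_sub _ _).trans (add_le_add h0 ((abs_sub _ _).trans (add_le_add h1' h2)))).trans (le_of_eq ?_)
  ring

/-- NOT IN PRINT; OUR BOOKKEEPING.  **THE LETTER: THE FACE POTENTIALS OF TWO TOP-ALIGNED DRESSED PARTIAL-CHAIN OUTPUTS DIFFER BY `θ^{ℓ+j} ×` THE UNDIFFERENCED LETTER, IN SUP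
CURRENCY** (`d = 3`, in-block roots `r, rr`; PARAMETRIC in CT-4a's `c, θ, κ₁`): for ALL `ℓ j μ z x`,
`|facePotential r Lc (legAct (legChain R (ℓ+1) j) δ_{μz}) x − facePotential r Lc (legAct (legChain R ℓ j) δ_{μz}) x| ≤ faceWtSum r Lc·(1 + 8·Lc·(e^{κ₁}+1))·(c·θ^{ℓ+j})·(Lc^{5(j+1)})⁻¹·e^{−κ₁‖quo (Lc^{j+1}) x − z‖∞}`
(`R = respStepBmSeq (toSite rr) Lc`) — §1 + `abs_axProjBmAt_respStep_sub_delta1_le` on the `Lc`-block of `x`, which has the source-scale label of `x`.  For the (III′) rate chains: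
`ℓ = i`, `j = k − i` ⇒ rate `θ^k` UNIFORMLY in the scale. -/
theorem abs_facePotential_legChain_succ_sub_le (ℓ j : ℕ) (μ : Fin (3 + 1)) (z : Site (3 + 1)) (x : Site (3 + 1)) :
    |facePotential r Lc (legAct (legChain (respStepBmSeq (d := 3) (toSite rr) Lc) (ℓ + 1) j) (delta1 μ z)) x
        - facePotential r Lc (legAct (legChain (respStepBmSeq (d := 3) (toSite rr) Lc) ℓ j) (delta1 μ z)) x|
      ≤ faceWtSum r Lc * ((1 + 8 * (Lc : ℝ) * (Real.exp κ₁ + 1)) * (c * θ ^ (ℓ + j)) * ((Lc : ℝ) ^ (5 * (j + 1)))⁻¹ *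
          Real.exp (-(κ₁ * supNorm (quo (Lc ^ (j + 1)) x - z)))) := by
  have e := congrFun (facePotential_legChain_succ_sub_eq hr hrr ℓ j (summable_delta1 μ z)) x
  rw [Pi.sub_apply] at e
  rw [e]
  refine abs_facePotential_le_of_abs_le (Nat.pos_of_ne_zero (NeZero.ne Lc)) hr _ x fun α b hb => ?_
  have h := abs_axProjBmAt_respStep_sub_delta1_le hκ₁ hc hθ hCau hrr ℓ j μ z α (((Lc : ℕ) : ℤ) • blk Lc x + toSite b)
  have hlab : quo (Lc ^ (j + 1)) (((Lc : ℕ) : ℤ) • blk Lc x + toSite b) = quo (Lc ^ (j + 1)) x := by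
    show blk (Lc ^ (j + 1)) (((Lc : ℕ) : ℤ) • blk Lc x + toSite b) = blk (Lc ^ (j + 1)) x
    rw [pow_succ', ← blk_blk, ← blk_blk, blk_block (blk Lc x) hb]
  rw [hlab] at h
  exact h

end Four

end Summit.QuantumFields.BalabanUV.Beta.GAN24.CombFacePotentialCauchy

end
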